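/-
Copyright (c) 2026 the pub-hodgecm-mathlib formalisation cell (harness21).  Prover seat hodgecm-mathlib-K2Liu-p27 (g3) = F4 (G-gen) desk, Track B «K2-LIT» ∕ hLiu418,
#42F′ FACE-G organ F4, B3-b DIRECTED (RULING F4-DX 2026-09-05T00:36:27Z): ★ FILE 2b∕2c∕2d re-run with the (deriv) closure letter of the DIRECTED F1.  THEOREMS ONLY.
-/
import Summits.HodgeConjecture.HodgeConjecture.Theorems.K2LiuArchSWDataInduction            -- ★ B3-b FILE 2b (LH7-p07): `genFamily_add ∕ _smul`, `vac_good_of_base` (+ ★ 2a, ★ FILE 1)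
import Summits.HodgeConjecture.HodgeConjecture.Theorems.K2LiuArchSWPivotDischarge           -- ★ (A) (K2E3-p25): `swSection_junctionSlot_κOp_eq_vacScalar_mul_at_junctionFrames` (the see-saw pivot, right leg discharged)
import Summits.HodgeConjecture.HodgeConjecture.Theorems.K2LiuFockKHInvariantsFFT            -- ★ (K2Liu-p23): `blockFFT`, `blockFFT_swap`
import Summits.HodgeConjecture.HodgeConjecture.Theorems.K2LiuArchSWDataDomainLetters         -- ★ (K2E3-p31): `hdom_of_hermiteData`, `hHL_of_hermiteData`
import Summits.HodgeConjecture.HodgeConjecture.Theorems.K2LiuArchSWDataDerivLettersDirected  -- (K2Liu-p05) (a): `hDXp∕hDXm_directed_of_onePlaceLetter`, `onePlaceLetter_directed_of_junctionFrames`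
import HarnessLib

/-!
# Crux `HLiu418`, #42F′ FACE-G, organ F4 (G-gen), B3-b DIRECTED: `Good` at every tuple vector when the (deriv) closure is offered ONLY along `DX`-directions

Cell `hodgecm-mathlib`, crux item hLiu418 = `stmt-HodgeConjecture-24832` (helper lane `--kind proof --supports stmt-HodgeConjecture-24832 --as helper`, count-neutral;
closes no socket); squad K2 ∕ K2Liu; LEAD F0P6-plan (g15); F4 desk K2Liu-p27 (g3) (RULING F4-DX, 2026-09-05T00:36:27Z); box K2E5-r02 (g7) ∕ K2Liu-audit1 (g3).
THEOREMS ONLY (no `def`, no `instance`, no notation, no local instance attribute, no named-fact hypothesis, no `sorry`; the commutator Lie ring on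
`Matrix (Fin 2 ⊕ Fin 2) … ℂ` for `𝔲(2,2) = (uFormGroup (Fin 2) (Fin 2)).lie` enters by `letI` inside the one binder that needs it, as ★ K2Liu-p05's (D-let)).

WHY.  The #42F′ tie of record is the DIRECTED F1 ★ `K2LiuFaceGAssemblerDirected.faceG_of_organs_directed (DX) (HL)` (its theta-side letter L2 is payable only at the
chart-image directions `DX′`), and ITS L3 binder `hGgen` (binder 3 of `faceG_of_organs_directed DX HL`) hands the payer a (deriv) closure letter RESTRICTED to the
directions `X` with `DX X` (★ :220–228).  ★ FILE 2b∕2c∕2d (`K2LiuArchSWDataInduction(OfRecord∕Final)`) were typed against the UNDIRECTED ★ `faceG_of_organs`'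
`hGgen` (closure along every `X ∈ archSkew`), so they pay the undirected `slot_Ggen` but cannot be fed the directed hypothesis.  Road (E) never differentiates along a
general `X`: its (DX⁺)(DX⁻) steps run along the sixteen chart-image letters per real place, whose `X` comes WITH the chart identity
`archExp hX s = archEmb (placeSecJ_𝔻 σ … (exp sY, 1))` (★ `exists_archSkew_archExp_eq_placeSecJ_expMem`), i.e. with a `DX`-witness under the one letter `hDX` «`DX` holds at
every chart-image direction».  ★ FILE 2a `K2LiuArchSWDataInductionLift.goodAt_tuple_of_placeLetters` is GENERIC in the direction type `Ξ` and the derivative relation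
`Der`, so the directed induction is FILE 2b's proof at `Ξ := {X // X ∈ archSkew ∧ DX X}` — no new mathematics, no spanning ∕ injectivity lemma for the chart.
* §1 **`good_tupleVec_of_frame_directed (DX)`** — ★ FILE 2b `good_tupleVec_of_frame` with (i) the (deriv) closure letter in the DIRECTED bytes (`(_hXD : DX X)` after
  `hX`), (ii) the derivative letters (DX⁺)(DX⁻) producing `DX`-directions (`DX X ∧` as first conjunct — the conclusion bytes of ★ K2Liu-p05
  `K2LiuArchSWDataDerivLettersDirected.hDXp∕hDXm_directed_of_onePlaceLetter`); everything else (abstract one-place frames `J σ`, (piv) in `J`-form, `hR hS`, (dom), (vac))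
  = ★ 2b's binders VERBATIM; proof = ★ 2b's with `Ξ`, `Der` and the two adapters edited.
* §2 **`good_tupleVec_directed_at_junctionFrames (DX)`** — §1 AT THE JUNCTION FRAMES OF RECORD (F4 desk 2026-09-05T00:19:48Z: `R σ := PosIdx (y σ)`, `S σ := NegIdx (y σ)`,
  `eP σ := (eP₀ σ)⁻¹ ≫ ((eSp σ)⁻¹ × 1 ⊕ (eSq σ)⁻¹ × 1)`, `eQ σ` twin; `J σ := 𝒥_σ` by ★ FILE 1 `frame_tupleVec_eq_tensorPi`) with every per-place letter DISCHARGED BY NAME: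
  (piv) := ★ (A) `K2LiuArchSWPivotDischarge.swSection_junctionSlot_κOp_eq_vacScalar_mul_at_junctionFrames` (K2E3-p25; right-leg letters (R-grp) ★ p863593 + (R-det) ★ p863469
  inside), read through `genFamily` by ★ `swSectionTensor_apply` + ★ `stdExtension_smul` (★ FILE 2d ED. 1's glue); `hR hS` := ★ `K2LiuFockKHInvariantsFFT.blockFFT ∕ blockFFT_swap`
  (K2Liu-p23); (DX⁺)(DX⁻) := ★ K2Liu-p05's directed letters ∘ ★ `onePlaceLetter_directed_of_junctionFrames … hDX`; (dom) := ★ K2E3-p31 `hdom_of_hermiteData hdat`; (vac) := ★ 2b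
  `vac_good_of_base` ∘ ★ `hHL_of_hermiteData (hdat 0)` + (base) at the hol cut of record `HLrecOfRecord` (★ LH7-p05).  Residual letters: the DIRECTED `hGgen` closure letters
  (congr)(zero)(add)(smul)(deriv) + (base), the Hermite data `hdat : ∀ D, IsArchDatum … 𝒦 V_D` (★ σ15 ∕ ★ `isArchDatum_hermiteSpan_of_closure_kV` modulo the standing closure
  letter `hK₀`), `χb`'s odd unitary arch type `ht hodd`, `hα : Continuous α`, the frame package `(y hy hz eP₀ eQ₀ hE eSp eSq hyσ)` (★ `exists_junctionFrameData_embedding` +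
  ★ `exists_signFrame_two`, `hyσ := fun _ _ => rfl`) and the direction letter `hDX`.  Consumer: F4-END `K2LiuFaceGGeneratorsInDomainOfRecord.hGgen_of_record` (★ FILE 3
  `forall_domain_good_of_archGenerators` ∘ §2 ∘ ★ (E-g-glue)).
References: [Howe1989] R. Howe, Remarks on classical invariant theory, Trans. AMS 313 (1989) §3 (the polynomial Fock model is generated from the vacuum by `𝔭⁺` modulo
`K`-invariants); [KudlaRallis1994] S. Kudla, S. Rallis, Ann. of Math. 140 (1994) §1 Thm. 1.1, §3; [Folland1989] G. B. Folland, Harmonic Analysis in Phase Space, §1.7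
(1.81), §4.2 Prop. (4.39); [Weyl1939] H. Weyl, The Classical Groups, Thm. 2.6.A; [KonnoKonno2007] Lemma 5.2 p. 73; [Weil1964] A. Weil, Acta Math. 111 (1964) Chap. I n° 12
p. 160; [Liu2021] Y. Liu, Camb. J. Math. 9 (2021) App. B proof of Prop. B.8 pp. 103–106 — citations for the docstrings; the file is bookkeeping over ★ files.
HONEST LABEL.  Count-neutral helper; `HC_CM` is proved only modulo the 7 printed citations (2 remaining named inputs: hLiu418 = `stmt-HodgeConjecture-24832`,
h413 = `stmt-HodgeConjecture-24833`) until rung 0 closes.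
-/

set_option autoImplicit false
set_option linter.dupNamespace false -- the mandated namespace repeats `HodgeConjecture.HodgeConjecture`

noncomputable section

open scoped Classical Matrix MatrixGroups TensorProduct Kronecker SchwartzMap Real
open MvPolynomial Complex
open NumberField NumberField.InfinitePlace NumberField.mixedEmbedding IsDedekindDomain
open Literature.Analysis.SegalBargmann Literature.RepresentationTheory.HeisenbergGroup
open Literature.NumberTheory.Automorphic Literature.NumberTheory.Automorphic.UnitaryGroup Literature.NumberTheory.GaloisRepresentations
open Literature.NumberTheory.Weil1964 Literature.NumberTheory.Weil1964.MpS Literature.NumberTheory.Weil1964.UnitaryWeil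
open Literature.RepresentationTheory.HarrisKudlaSweet1996
open Literature.RepresentationTheory.KonnoKonno2007 Literature.RepresentationTheory.KonnoKonno2007.RealDualPair
open Literature.RepresentationTheory.KonnoKonno2007.RealDualPair.UForm
open Literature.NumberTheory.GelbartRogawski1991 Literature.NumberTheory.GelbartRogawski1991.GRConstruction
open Literature.NumberTheory.GelbartRogawski1991.UnitaryDualPair
open Literature.NumberTheory.GelbartRogawski1991.UnitaryDualPair.LocalSplitting
open Literature.NumberTheory.K2Lit.SiegelDoubled
open Literature.NumberTheory.Automorphic.Liu2021
open Literature.NumberTheory.Automorphic.Liu2021.Def411WeilCarriers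
open Literature.NumberTheory.Automorphic.Liu2021.Def411WeilCarriersDoubling
open Literature.RepresentationTheory.Liu2021
open Summit.HodgeConjecture.HodgeConjecture.Cruxes.HLiu418.K2LiuArchSectionPlaceBlock
open Summit.HodgeConjecture.HodgeConjecture.Cruxes.HLiu418.K2LiuFaceGLetterDefs (IsArchStable genFamily HasArchDeriv)
open Summit.HodgeConjecture.HodgeConjecture.Cruxes.HLiu418.K2LiuArchSWDataTuplesDefs
open Summit.HodgeConjecture.HodgeConjecture.Cruxes.HLiu418.K2LiuArchSWDataInductionLift
open Summit.HodgeConjecture.HodgeConjecture.Cruxes.HLiu418.K2LiuArchSWDataInduction (genFamily_add genFamily_smul vac_good_of_base)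
open Summit.HodgeConjecture.HodgeConjecture.Cruxes.HLiu418.K2LiuArchSWSpanningDefs (IsArchDatum)
open Summit.HodgeConjecture.HodgeConjecture.Cruxes.HLiu418.K2LiuArchGaussianOfRecord (HLrecOfRecord)

namespace Summit.HodgeConjecture.HodgeConjecture.Cruxes.HLiu418.K2LiuArchSWDataInductionDirected

variable (L : Type) [Field L] [NumberField L] [IsCMField L] {n : ℕ} (e : Fin 2 × Fin 1 ≃ Fin n)
  (dV : Fin 2 → L) (hdV : ∀ i, IsCMField.complexConj L (dV i) = dV i) (hdV0 : ∀ i, dV i ≠ 0)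
  (dW : Fin 1 → L) (hdW : ∀ i, IsCMField.complexConj L (dW i) = dW i) (hdW0 : ∀ i, dW i ≠ 0)
  {M' n' : ℕ} (eW : Fin 1 × Fin 3 ≃ Fin M') (e' : Fin 2 × Fin M' ≃ Fin n')
  (dV' : Fin 3 → L) (hdV' : ∀ k, IsCMField.complexConj L (dV' k) = dV' k) (hdV'0 : ∀ k, dV' k ≠ 0)
  (χb : HeckeCharacter L) (hχbu : χb.IsUnitary) (hχbs : Literature.RepresentationTheory.HarrisKudlaSweet1996.IsSplittingChar L 1 χb)
  (α : UnitaryGroup.adelicOne (Fp L) L (IsCMField.complexConj L) →* ℂˣ) (𝒦 : IwasawaDatum L e dV hdV dW hdW)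
  (R S : {v : InfinitePlace (Fp L) // v.IsReal} → Type) [∀ σ, Fintype (R σ)] [∀ σ, DecidableEq (R σ)] [∀ σ, Fintype (S σ)] [∀ σ, DecidableEq (S σ)]
  (eP : ∀ σ : {v : InfinitePlace (Fp L) // v.IsReal}, PosIdx (signVec (cmPlaceOver L) (fun k => Sum.elim (cmGramEntry L e' dV hdV (tensorFrame L dW eW dV') (tensorFrame_real L dW hdW eW dV' hdV')) (-cmGramEntry L e' dV hdV (tensorFrame L dW eW dV') (tensorFrame_real L dW hdW eW dV' hdV')) ((LocalSplitting.e₂ n').symm k)) (imagUnit L) σ) ≃ (Fin 2 × R σ) ⊕ (Fin 2 × S σ))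
  (eQ : ∀ σ : {v : InfinitePlace (Fp L) // v.IsReal}, NegIdx (signVec (cmPlaceOver L) (fun k => Sum.elim (cmGramEntry L e' dV hdV (tensorFrame L dW eW dV') (tensorFrame_real L dW hdW eW dV' hdV')) (-cmGramEntry L e' dV hdV (tensorFrame L dW eW dV') (tensorFrame_real L dW hdW eW dV' hdV')) ((LocalSplitting.e₂ n').symm k)) (imagUnit L) σ) ≃ (Fin 2 × S σ) ⊕ (Fin 2 × R σ))
  (ev : {v : InfinitePlace (Fp L) // v.IsReal} → VacExponents)
/-! ## §1 The place-tuple induction along `DX`-directions, for an abstract family of one-place frames -/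

set_option maxHeartbeats 4000000 in
/-- **B3-b DIRECTED — `Good` AT EVERY TUPLE VECTOR along `DX`-directions, for an abstract family of one-place frames `J σ`** (★ FILE 2b `good_tupleVec_of_frame` with the (deriv) closure letter RESTRICTED to the directions `X` with `DX X` — ★ F1 ED. 2 `faceG_of_organs_directed`'s `hGgen` :220–228 — and the derivative letters (DX⁺)(DX⁻) producing `DX`-directions; proof = ★ 2b's at `Ξ := {X // X ∈ archSkew ∧ DX X}`, ★ FILE 2a being generic in `Ξ`). reading every tuple vector as «(`σ`-slot) ⊠ (rest)»
(`hJ`, = ★ FILE 1 `frame_tupleVec_eq_tensorPi` for `J := 𝒥`).  Hypotheses: `hGgen`'s closure letters (congr)(zero)(add)(smul)(deriv) verbatim; (dom) (★ FILE 3 bytes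
at `t := tupleVec`); per real place `σ`: the see-saw pivot (piv) in `ha`-form, the block first fundamental theorems `hR hS` (★ B3-a ED. 3 bytes), the derivative
letters (DX⁺)(DX⁻) (`Good`-free, tuple level); and (vac).  Conclusion: ★ FILE 3's letter (gen) at `t := tupleVec` — `Good V′ ⟨E(tupleVec a ⊗ f), hx⟩` for every tuple
`a`, every `f` and every finite-dimensional arch-stable `V′` whose domain contains it.  Proof: ★ FILE 2a `goodAt_tuple_of_placeLetters` at `SW σ rest :=
v ↦ g (E (J σ)⁻¹((e_* v) ⊠ B⁻¹(tupleRest σ rest)) f)` (linear by ★ `tensorPi_add_left ∕ _smul_left` and §1). [cite: Howe1989, §3] [cite: KudlaRallis1994, §3]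
[cite: Folland1989, §1.7 (1.81), Prop. (4.39)] [cite: Weil1964, Chap. I n° 12 p. 160] -/
theorem good_tupleVec_of_frame_directed (DX : Matrix (Fin (n + n)) (Fin (n + n)) (mixedSpace L) → Prop)
    (Good : (V : Submodule ℂ 𝓢(((Fin (n' + n')) → mixedSpace (Fp L)), ℂ)) → ↥(Submodule.span ℂ {x : piSchwartzBruhat (Fp L) (Fin (n' + n')) |
          ∃ a ∈ V, ∃ f : FinSB (Fp L) (Fin (n' + n')), x = piSchwartzBruhatEquiv (Fp L) (Fin (n' + n')) (a ⊗ₜ[ℂ] f)}) → Prop)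
    -- (congr) (zero) (add) (smul) (deriv): ★ `hGgen` bytes verbatim
    (hcongr : ∀ (V V' : Submodule ℂ 𝓢(((Fin (n' + n')) → mixedSpace (Fp L)), ℂ)) (x : ↥(Submodule.span ℂ {x : piSchwartzBruhat (Fp L) (Fin (n' + n')) |
          ∃ a ∈ V, ∃ f : FinSB (Fp L) (Fin (n' + n')), x = piSchwartzBruhatEquiv (Fp L) (Fin (n' + n')) (a ⊗ₜ[ℂ] f)})) (x' : ↥(Submodule.span ℂ {x : piSchwartzBruhat (Fp L) (Fin (n' + n')) |
          ∃ a ∈ V', ∃ f : FinSB (Fp L) (Fin (n' + n')), x = piSchwartzBruhatEquiv (Fp L) (Fin (n' + n')) (a ⊗ₜ[ℂ] f)})),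
      genFamily L e dV hdV hdV0 dW hdW hdW0 eW e' dV' hdV' hdV'0 χb hχbu hχbs α 𝒦 (x : piSchwartzBruhat (Fp L) (Fin (n' + n'))) =
        genFamily L e dV hdV hdV0 dW hdW hdW0 eW e' dV' hdV' hdV'0 χb hχbu hχbs α 𝒦 (x' : piSchwartzBruhat (Fp L) (Fin (n' + n'))) → Good V x → Good V' x')
    (hzero : ∀ (V : Submodule ℂ 𝓢(((Fin (n' + n')) → mixedSpace (Fp L)), ℂ)), FiniteDimensional ℂ V → IsArchStable L e dV hdV hdV0 dW hdW hdW0 eW e' dV' hdV' hdV'0 χb hχbu hχbs 𝒦 V → Good V 0)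
    (hadd : ∀ (V : Submodule ℂ 𝓢(((Fin (n' + n')) → mixedSpace (Fp L)), ℂ)), FiniteDimensional ℂ V → IsArchStable L e dV hdV hdV0 dW hdW hdW0 eW e' dV' hdV' hdV'0 χb hχbu hχbs 𝒦 V →
      ∀ x y : ↥(Submodule.span ℂ {x : piSchwartzBruhat (Fp L) (Fin (n' + n')) |
          ∃ a ∈ V, ∃ f : FinSB (Fp L) (Fin (n' + n')), x = piSchwartzBruhatEquiv (Fp L) (Fin (n' + n')) (a ⊗ₜ[ℂ] f)}), Good V x → Good V y → Good V (x + y))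
    (hsmul : ∀ (V : Submodule ℂ 𝓢(((Fin (n' + n')) → mixedSpace (Fp L)), ℂ)), FiniteDimensional ℂ V → IsArchStable L e dV hdV hdV0 dW hdW hdW0 eW e' dV' hdV' hdV'0 χb hχbu hχbs 𝒦 V →
      ∀ (c : ℂ) (x : ↥(Submodule.span ℂ {x : piSchwartzBruhat (Fp L) (Fin (n' + n')) |
          ∃ a ∈ V, ∃ f : FinSB (Fp L) (Fin (n' + n')), x = piSchwartzBruhatEquiv (Fp L) (Fin (n' + n')) (a ⊗ₜ[ℂ] f)})), Good V x → Good V (c • x))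
    (hderiv : ∀ (V : Submodule ℂ 𝓢(((Fin (n' + n')) → mixedSpace (Fp L)), ℂ)), FiniteDimensional ℂ V → IsArchStable L e dV hdV hdV0 dW hdW hdW0 eW e' dV' hdV' hdV'0 χb hχbu hχbs 𝒦 V →
          ∀ x : ↥(Submodule.span ℂ {x : piSchwartzBruhat (Fp L) (Fin (n' + n')) |
          ∃ a ∈ V, ∃ f : FinSB (Fp L) (Fin (n' + n')), x = piSchwartzBruhatEquiv (Fp L) (Fin (n' + n')) (a ⊗ₜ[ℂ] f)}), Good V x →
          ∀ (X : Matrix (Fin (n + n)) (Fin (n + n)) (mixedSpace L)) (hX : X ∈ archSkew (Fp L) L (IsCMField.complexConj L) (n + n) (hermD L e dV hdV dW hdW)) (_hXD : DX X)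
            (V' : Submodule ℂ 𝓢(((Fin (n' + n')) → mixedSpace (Fp L)), ℂ)), FiniteDimensional ℂ V' → IsArchStable L e dV hdV hdV0 dW hdW hdW0 eW e' dV' hdV' hdV'0 χb hχbu hχbs 𝒦 V' →
          ∀ x' : ↥(Submodule.span ℂ {x : piSchwartzBruhat (Fp L) (Fin (n' + n')) |
          ∃ a ∈ V', ∃ f : FinSB (Fp L) (Fin (n' + n')), x = piSchwartzBruhatEquiv (Fp L) (Fin (n' + n')) (a ⊗ₜ[ℂ] f)}),
          HasArchDeriv L e dV hdV dW hdW hX (fun h => genFamily L e dV hdV hdV0 dW hdW hdW0 eW e' dV' hdV' hdV'0 χb hχbu hχbs α 𝒦 (x : piSchwartzBruhat (Fp L) (Fin (n' + n'))) ((((3 : ℕ) : ℂ) - (n : ℂ)) / 2) h)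
            (fun h => genFamily L e dV hdV hdV0 dW hdW hdW0 eW e' dV' hdV' hdV'0 χb hχbu hχbs α 𝒦 (x' : piSchwartzBruhat (Fp L) (Fin (n' + n'))) ((((3 : ℕ) : ℂ) - (n : ℂ)) / 2) h) → Good V' x')
    -- (dom) the degree ledger BY VALUE: every finite set of tuple vectors lies in some finite-dimensional arch-stable space (★ FILE 3's letter bytes at `t := tupleVec`)
    (hdom : ∀ s : Finset ((σ : {v : InfinitePlace (Fp L) // v.IsReal}) → MvPolynomial (DPIdx (Fin 2) (Fin 2) (R σ) (S σ)) ℂ), ∃ V' : Submodule ℂ 𝓢(((Fin (n' + n')) → mixedSpace (Fp L)), ℂ),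
      FiniteDimensional ℂ V' ∧ IsArchStable L e dV hdV hdV0 dW hdW hdW0 eW e' dV' hdV' hdV'0 χb hχbu hχbs 𝒦 V' ∧ ∀ β ∈ s, tupleVec L dV hdV hdV0 dW hdW hdW0 eW e' dV' hdV' hdV'0 R S eP eQ β ∈ V')
    -- the one-place frames and their reading of tuple vectors
    (J : ∀ σ : {v : InfinitePlace (Fp L) // v.IsReal}, (𝓢(((Fin (n' + n')) → mixedSpace (Fp L)), ℂ) ≃L[ℂ]
      𝓢(((DPIdx ((Fin 2 × R σ) ⊕ (Fin 2 × S σ)) ((Fin 2 × S σ) ⊕ (Fin 2 × R σ)) Unit Empty ⊕ (Fin (n' + n') × {v : {v : InfinitePlace (Fp L) // v.IsReal} // v ≠ σ})) → ℝ), ℂ)))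
    (hJ : ∀ (σ : {v : InfinitePlace (Fp L) // v.IsReal}) (a : ((σ : {v : InfinitePlace (Fp L) // v.IsReal}) → MvPolynomial (DPIdx (Fin 2) (Fin 2) (R σ) (S σ)) ℂ)), J σ (tupleVec L dV hdV hdV0 dW hdW hdW0 eW e' dV' hdV' hdV'0 R S eP eQ a) =
      tensorPi (schwartzTransport (reindexCLE (unitJunctionIdx ((Fin 2 × R σ) ⊕ (Fin 2 × S σ)) ((Fin 2 × S σ) ⊕ (Fin 2 × R σ))).symm) (binvPi (a σ)))
        (binvPi (tupleRest (fun τ : {v : InfinitePlace (Fp L) // v.IsReal} => unitJunctionIdx ((Fin 2 × R τ) ⊕ (Fin 2 × S τ)) ((Fin 2 × S τ) ⊕ (Fin 2 × R τ)))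
          (frameSlotEquiv L dV hdV dW hdW eW e' dV' hdV' R S eP eQ) σ a)))
    -- (piv) THE SEE-SAW PIVOT BY VALUE, in ★ J2c's `ha`-form: moving the `σ`-slot by `κOp (1,k)`, `k ∈ K_H = U(R_σ) × U(S_σ)`, multiplies the twisted generator
    -- family by the vacuum scalar (★ (P-arch) p863113 + (R-grp) K2E3-p31 + ★ `swSection_mul_right` + ★ SW-law + ★ (R-scal) p863266; composed by the pivot file)
    (hpiv : ∀ (σ : {v : InfinitePlace (Fp L) // v.IsReal}) (k : Matrix.unitaryGroup (R σ) ℂ × Matrix.unitaryGroup (S σ) ℂ) (v : SchwartzMap (DPIdx (Fin 2) (Fin 2) (R σ) (S σ) → ℝ) ℂ)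
      (w : 𝓢(((Fin (n' + n') × {v : {v : InfinitePlace (Fp L) // v.IsReal} // v ≠ σ}) → ℝ), ℂ)) (f : FinSB (Fp L) (Fin (n' + n'))) (a a' : 𝓢(((Fin (n' + n')) → mixedSpace (Fp L)), ℂ)),
      J σ a = tensorPi (schwartzTransport (reindexCLE (unitJunctionIdx ((Fin 2 × R σ) ⊕ (Fin 2 × S σ)) ((Fin 2 × S σ) ⊕ (Fin 2 × R σ))).symm) v) w →
      J σ a' =
        tensorPi (schwartzTransport (reindexCLE (unitJunctionIdx ((Fin 2 × R σ) ⊕ (Fin 2 × S σ)) ((Fin 2 × S σ) ⊕ (Fin 2 × R σ))).symm) (κOp (R σ) (S σ) (ev σ) ((1, k) : DPK (Fin 2) (Fin 2) (R σ) (S σ)) v)) w →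
      genFamily L e dV hdV hdV0 dW hdW hdW0 eW e' dV' hdV' hdV'0 χb hχbu hχbs α 𝒦 (piSchwartzBruhatEquiv (Fp L) (Fin (n' + n')) (a' ⊗ₜ[ℂ] f)) =
        vacScalar (ev σ) ((1, k) : DPK (Fin 2) (Fin 2) (R σ) (S σ)) • genFamily L e dV hdV hdV0 dW hdW hdW0 eW e' dV' hdV' hdV'0 χb hχbu hχbs α 𝒦 (piSchwartzBruhatEquiv (Fp L) (Fin (n' + n')) (a ⊗ₜ[ℂ] f)))
    (hR : ∀ (σ : {v : InfinitePlace (Fp L) // v.IsReal}) (PR : MvPolynomial ((Fin 2 × R σ) ⊕ (Fin 2 × R σ)) ℂ),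
      (∀ c : Matrix.unitaryGroup (R σ) ℂ, aeval (Sum.elim (fun pr : Fin 2 × R σ => ∑ b : R σ, X (Sum.inl (pr.1, b)) * C ((c : Matrix (R σ) (R σ) ℂ) b pr.2))
          (fun qr : Fin 2 × R σ => ∑ b : R σ, X (Sum.inr (qr.1, b)) * C ((star (c : Matrix (R σ) (R σ) ℂ)) qr.2 b)) :
            (Fin 2 × R σ) ⊕ (Fin 2 × R σ) → MvPolynomial ((Fin 2 × R σ) ⊕ (Fin 2 × R σ)) ℂ) PR = PR) →
        PR ∈ Algebra.adjoin ℂ (Set.range fun ij : Fin 2 × Fin 2 =>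
          (∑ r : R σ, X (Sum.inl (ij.1, r)) * X (Sum.inr (ij.2, r)) : MvPolynomial ((Fin 2 × R σ) ⊕ (Fin 2 × R σ)) ℂ)))
    (hS : ∀ (σ : {v : InfinitePlace (Fp L) // v.IsReal}) (PS : MvPolynomial ((Fin 2 × S σ) ⊕ (Fin 2 × S σ)) ℂ),
      (∀ d : Matrix.unitaryGroup (S σ) ℂ, aeval (Sum.elim (fun pr : Fin 2 × S σ => ∑ b : S σ, X (Sum.inl (pr.1, b)) * C ((d : Matrix (S σ) (S σ) ℂ) b pr.2))
          (fun qr : Fin 2 × S σ => ∑ b : S σ, X (Sum.inr (qr.1, b)) * C ((star (d : Matrix (S σ) (S σ) ℂ)) qr.2 b)) :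
            (Fin 2 × S σ) ⊕ (Fin 2 × S σ) → MvPolynomial ((Fin 2 × S σ) ⊕ (Fin 2 × S σ)) ℂ) PS = PS) →
        PS ∈ Algebra.adjoin ℂ (Set.range fun ij : Fin 2 × Fin 2 =>
          (∑ s : S σ, X (Sum.inl (ij.2, s)) * X (Sum.inr (ij.1, s)) : MvPolynomial ((Fin 2 × S σ) ⊕ (Fin 2 × S σ)) ℂ)))
    -- (DX⁺) (DX⁻) the two derivative letters per place BY VALUE (`Good`-free): the boost `hypOpGen_{pq}` (resp. its `μ₀(D_{π∕2})`-conjugate) of the `σ`-slot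
    -- is the arch Lie derivative of the twisted generator family along some `X ∈ 𝔲` (★ W4 + ★ F2 + ★ (T2-an) + ★ FILE 1; payer named by LEAD)
    (hDXp : ∀ (σ : {v : InfinitePlace (Fp L) // v.IsReal}) (rest : ((τ : {v : InfinitePlace (Fp L) // v.IsReal}) → MvPolynomial (DPIdx (Fin 2) (Fin 2) (R τ) (S τ)) ℂ)) (i : Fin 2 × Fin 2) (F : MvPolynomial (DPIdx (Fin 2) (Fin 2) (R σ) (S σ)) ℂ) (f : FinSB (Fp L) (Fin (n' + n'))),
      ∃ (X : Matrix (Fin (n + n)) (Fin (n + n)) (mixedSpace L)) (hX : X ∈ archSkew (Fp L) L (IsCMField.complexConj L) (n + n) (hermD L e dV hdV dW hdW))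
        (c : ℂ) (G : MvPolynomial (DPIdx (Fin 2) (Fin 2) (R σ) (S σ)) ℂ), DX X ∧ binvPi G = hypOpGenC (R σ) (S σ) i.1 i.2 (binvPi F) ∧
        HasArchDeriv L e dV hdV dW hdW hX (fun h => genFamily L e dV hdV hdV0 dW hdW hdW0 eW e' dV' hdV' hdV'0 χb hχbu hχbs α 𝒦 (piSchwartzBruhatEquiv (Fp L) (Fin (n' + n')) (tupleVec L dV hdV hdV0 dW hdW hdW0 eW e' dV' hdV' hdV'0 R S eP eQ (Function.update rest σ F) ⊗ₜ[ℂ] f)) ((((3 : ℕ) : ℂ) - (n : ℂ)) / 2) h)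
          (fun h => genFamily L e dV hdV hdV0 dW hdW hdW0 eW e' dV' hdV' hdV'0 χb hχbu hχbs α 𝒦 (piSchwartzBruhatEquiv (Fp L) (Fin (n' + n')) (tupleVec L dV hdV hdV0 dW hdW hdW0 eW e' dV' hdV' hdV'0 R S eP eQ (Function.update rest σ (c • F + G)) ⊗ₜ[ℂ] f)) ((((3 : ℕ) : ℂ) - (n : ℂ)) / 2) h))
    (hDXm : ∀ (σ : {v : InfinitePlace (Fp L) // v.IsReal}) (rest : ((τ : {v : InfinitePlace (Fp L) // v.IsReal}) → MvPolynomial (DPIdx (Fin 2) (Fin 2) (R τ) (S τ)) ℂ)) (i : Fin 2 × Fin 2) (F : MvPolynomial (DPIdx (Fin 2) (Fin 2) (R σ) (S σ)) ℂ) (f : FinSB (Fp L) (Fin (n' + n'))),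
      ∃ (X : Matrix (Fin (n + n)) (Fin (n + n)) (mixedSpace L)) (hX : X ∈ archSkew (Fp L) L (IsCMField.complexConj L) (n + n) (hermD L e dV hdV dW hdW))
        (c : ℂ) (G : MvPolynomial (DPIdx (Fin 2) (Fin 2) (R σ) (S σ)) ℂ),
        DX X ∧ binvPi G = unitaryOpPi (phaseU (R σ) (S σ) i.1 (π / 2)) (hypOpGenC (R σ) (S σ) i.1 i.2 (unitaryOpPi (phaseU (R σ) (S σ) i.1 (π / 2))⁻¹ (binvPi F))) ∧
        HasArchDeriv L e dV hdV dW hdW hX (fun h => genFamily L e dV hdV hdV0 dW hdW hdW0 eW e' dV' hdV' hdV'0 χb hχbu hχbs α 𝒦 (piSchwartzBruhatEquiv (Fp L) (Fin (n' + n')) (tupleVec L dV hdV hdV0 dW hdW hdW0 eW e' dV' hdV' hdV'0 R S eP eQ (Function.update rest σ F) ⊗ₜ[ℂ] f)) ((((3 : ℕ) : ℂ) - (n : ℂ)) / 2) h)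
          (fun h => genFamily L e dV hdV hdV0 dW hdW hdW0 eW e' dV' hdV' hdV'0 χb hχbu hχbs α 𝒦 (piSchwartzBruhatEquiv (Fp L) (Fin (n' + n')) (tupleVec L dV hdV hdV0 dW hdW hdW0 eW e' dV' hdV' hdV'0 R S eP eQ (Function.update rest σ (c • F + G)) ⊗ₜ[ℂ] f)) ((((3 : ℕ) : ℂ) - (n : ℂ)) / 2) h))
    -- (vac) `Good` at the all-vacuum tuple (`tupleVec 1` = ★ `archGaussianOfRecord`) in every admissible domain containing it — (base) + (congr), cf. `vac_good_of_base`
    (hvac : ∀ f : FinSB (Fp L) (Fin (n' + n')), (∀ V' : Submodule ℂ 𝓢(((Fin (n' + n')) → mixedSpace (Fp L)), ℂ), FiniteDimensional ℂ V' →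
      IsArchStable L e dV hdV hdV0 dW hdW hdW0 eW e' dV' hdV' hdV'0 χb hχbu hχbs 𝒦 V' →
      ∀ hx : piSchwartzBruhatEquiv (Fp L) (Fin (n' + n')) (tupleVec L dV hdV hdV0 dW hdW hdW0 eW e' dV' hdV' hdV'0 R S eP eQ (fun _ => 1) ⊗ₜ[ℂ] f) ∈ Submodule.span ℂ {x : piSchwartzBruhat (Fp L) (Fin (n' + n')) |
          ∃ a ∈ V', ∃ f : FinSB (Fp L) (Fin (n' + n')), x = piSchwartzBruhatEquiv (Fp L) (Fin (n' + n')) (a ⊗ₜ[ℂ] f)},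
        Good V' ⟨piSchwartzBruhatEquiv (Fp L) (Fin (n' + n')) (tupleVec L dV hdV hdV0 dW hdW hdW0 eW e' dV' hdV' hdV'0 R S eP eQ (fun _ => 1) ⊗ₜ[ℂ] f), hx⟩)) :
    ∀ (a : ((σ : {v : InfinitePlace (Fp L) // v.IsReal}) → MvPolynomial (DPIdx (Fin 2) (Fin 2) (R σ) (S σ)) ℂ)) (f : FinSB (Fp L) (Fin (n' + n'))) (V' : Submodule ℂ 𝓢(((Fin (n' + n')) → mixedSpace (Fp L)), ℂ)), FiniteDimensional ℂ V' →
      IsArchStable L e dV hdV hdV0 dW hdW hdW0 eW e' dV' hdV' hdV'0 χb hχbu hχbs 𝒦 V' →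
      ∀ hx : piSchwartzBruhatEquiv (Fp L) (Fin (n' + n')) (tupleVec L dV hdV hdV0 dW hdW hdW0 eW e' dV' hdV' hdV'0 R S eP eQ a ⊗ₜ[ℂ] f) ∈ Submodule.span ℂ {x : piSchwartzBruhat (Fp L) (Fin (n' + n')) |
          ∃ a ∈ V', ∃ f : FinSB (Fp L) (Fin (n' + n')), x = piSchwartzBruhatEquiv (Fp L) (Fin (n' + n')) (a ⊗ₜ[ℂ] f)},
        Good V' ⟨piSchwartzBruhatEquiv (Fp L) (Fin (n' + n')) (tupleVec L dV hdV hdV0 dW hdW hdW0 eW e' dV' hdV' hdV'0 R S eP eQ a ⊗ₜ[ℂ] f), hx⟩ := by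
  intro a f V' hfd hst hx
  have hGadd := genFamily_add L e dV hdV hdV0 dW hdW hdW0 eW e' dV' hdV' hdV'0 χb hχbu hχbs α 𝒦
  have hGsmul := genFamily_smul L e dV hdV hdV0 dW hdW hdW0 eW e' dV' hdV' hdV'0 χb hχbu hχbs α 𝒦
  have key := goodAt_tuple_of_placeLetters (M := 𝓢(((Fin (n' + n')) → mixedSpace (Fp L)), ℂ)) (T := FinSB (Fp L) (Fin (n' + n'))) (N := piSchwartzBruhat (Fp L) (Fin (n' + n')))
    (Y := ℂ → HA L e dV hdV dW hdW → ℂ)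
    (fun (a : 𝓢(((Fin (n' + n')) → mixedSpace (Fp L)), ℂ)) (f : FinSB (Fp L) (Fin (n' + n'))) => piSchwartzBruhatEquiv (Fp L) (Fin (n' + n')) (a ⊗ₜ[ℂ] f))
    (fun V => FiniteDimensional ℂ V ∧ IsArchStable L e dV hdV hdV0 dW hdW hdW0 eW e' dV' hdV' hdV'0 χb hχbu hχbs 𝒦 V)
    (fun x => genFamily L e dV hdV hdV0 dW hdW hdW0 eW e' dV' hdV' hdV'0 χb hχbu hχbs α 𝒦 x) Good
    (Ξ := {X : Matrix (Fin (n + n)) (Fin (n + n)) (mixedSpace L) // X ∈ archSkew (Fp L) L (IsCMField.complexConj L) (n + n) (hermD L e dV hdV dW hdW) ∧ DX X})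
    (fun ξ y y' => HasArchDeriv L e dV hdV dW hdW ξ.2.1 (fun h => y ((((3 : ℕ) : ℂ) - (n : ℂ)) / 2) h) (fun h => y' ((((3 : ℕ) : ℂ) - (n : ℂ)) / 2) h))
    R S ev (tupleVec L dV hdV hdV0 dW hdW hdW0 eW e' dV' hdV' hdV'0 R S eP eQ)
    (fun σ rest F G => tupleVecOf_update_add (fun τ : {v : InfinitePlace (Fp L) // v.IsReal} => unitJunctionIdx ((Fin 2 × R τ) ⊕ (Fin 2 × S τ)) ((Fin 2 × S τ) ⊕ (Fin 2 × R τ)))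
      (frameSlotEquiv L dV hdV dW hdW eW e' dV' hdV' R S eP eQ) (frameD L e' dV hdV hdV0 (tensorFrame L dW eW dV') (tensorFrame_real L dW hdW eW dV' hdV') (tensorFrame_ne_zero L dW eW dV' hdW0 hdV'0)) σ rest F G)
    (fun σ rest c F => tupleVecOf_update_smul (fun τ : {v : InfinitePlace (Fp L) // v.IsReal} => unitJunctionIdx ((Fin 2 × R τ) ⊕ (Fin 2 × S τ)) ((Fin 2 × S τ) ⊕ (Fin 2 × R τ)))
      (frameSlotEquiv L dV hdV dW hdW eW e' dV' hdV' R S eP eQ) (frameD L e' dV hdV hdV0 (tensorFrame L dW eW dV') (tensorFrame_real L dW hdW eW dV' hdV') (tensorFrame_ne_zero L dW eW dV' hdW0 hdV'0)) σ rest c F)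
    -- `SW σ rest`: the twisted generator family of the datum whose `σ`-slot is `v` and whose other slots are `B⁻¹(tupleRest σ rest)`
    (fun σ rest =>
      { toFun := fun v => genFamily L e dV hdV hdV0 dW hdW hdW0 eW e' dV' hdV' hdV'0 χb hχbu hχbs α 𝒦 (piSchwartzBruhatEquiv (Fp L) (Fin (n' + n')) ((J σ).symm (tensorPi (schwartzTransport (reindexCLE (unitJunctionIdx ((Fin 2 × R σ) ⊕ (Fin 2 × S σ)) ((Fin 2 × S σ) ⊕ (Fin 2 × R σ))).symm) v) (binvPi (tupleRest (fun τ : {v : InfinitePlace (Fp L) // v.IsReal} => unitJunctionIdx ((Fin 2 × R τ) ⊕ (Fin 2 × S τ)) ((Fin 2 × S τ) ⊕ (Fin 2 × R τ)))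
          (frameSlotEquiv L dV hdV dW hdW eW e' dV' hdV' R S eP eQ) σ rest))) ⊗ₜ[ℂ] f))
        map_add' := fun v v' => by
          simp only [map_add, tensorPi_add_left, TensorProduct.add_tmul, hGadd]
        map_smul' := fun c v => by
          simp only [map_smul, tensorPi_smul_left]
          rw [← TensorProduct.smul_tmul', map_smul, hGsmul, RingHom.id_apply] })
    (fun σ rest k v => by
      simp only [LinearMap.coe_mk, AddHom.coe_mk]
      exact hpiv σ k v _ f _ _ (by rw [ContinuousLinearEquiv.apply_symm_apply]) (by rw [ContinuousLinearEquiv.apply_symm_apply]))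
    hR hS
    (fun a b f => by simp only [TensorProduct.add_tmul, map_add])
    (fun c a f => by simp only [← TensorProduct.smul_tmul', map_smul])
    hcongr (fun V h => hzero V h.1 h.2) (fun V h => hadd V h.1 h.2) (fun V h => hsmul V h.1 h.2)
    (fun V h x hx ξ V' h' x' hD => hderiv V h.1 h.2 x hx ξ.1 ξ.2.1 ξ.2.2 V' h'.1 h'.2 x' hD)
    (fun a b => by
      obtain ⟨V', h1, h2, h3⟩ := hdom {a, b}
      exact ⟨V', ⟨h1, h2⟩, h3 a (Finset.mem_insert_self a _), h3 b (Finset.mem_insert_of_mem (Finset.mem_singleton_self b))⟩)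
    f
    (fun σ rest F => by
      simp only [LinearMap.coe_mk, AddHom.coe_mk]
      have h := hJ σ (Function.update rest σ F)
      rw [Function.update_self, tupleRest_update] at h
      rw [← h, ContinuousLinearEquiv.symm_apply_apply])
    (fun σ rest i F => by
      obtain ⟨X, hX, c, G, hXD, hG, hD⟩ := hDXp σ rest i F f
      exact ⟨⟨X, hX, hXD⟩, c, G, hG, hD⟩)
    (fun σ rest i F => by
      obtain ⟨X, hX, c, G, hXD, hG, hD⟩ := hDXm σ rest i F f
      exact ⟨⟨X, hX, hXD⟩, c, G, hG, hD⟩)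
    (fun V' h hx => hvac f V' h.1 h.2 hx) a
  exact key V' ⟨hfd, hst⟩ hx
/-! ## §2 At the junction frames of record: every letter of §1 discharged by name but the closure letters, (base), the Hermite data and the direction letter -/

set_option maxHeartbeats 4000000 in -- as ★ FILE 2c∕2d (the CM sign frames and J2c's frame chain)
/-- **B3-b DIRECTED AT THE JUNCTION FRAMES OF RECORD — `Good` AT EVERY TUPLE VECTOR from the closure letters of the DIRECTED `hGgen`, (base) at the hol cut of record, the
Hermite data `hdat` and the direction letter `hDX`.**  §1 at J2c's one-place frames `𝒥_σ` (`hJ` := ★ FILE 1 `frame_tupleVec_eq_tensorPi`) over the frames of record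
`R σ := PosIdx (y σ)`, `S σ := NegIdx (y σ)`, `eP σ := (eP₀ σ)⁻¹ ≫ ((eSp σ)⁻¹ × 1 ⊕ (eSq σ)⁻¹ × 1)`, `eQ σ` twin, with: (piv) := ★ (A) `K2LiuArchSWPivotDischarge.
swSection_junctionSlot_κOp_eq_vacScalar_mul_at_junctionFrames` (right leg discharged; read through `genFamily` by ★ `swSectionTensor_apply` + ★ `stdExtension_smul`); `hR hS` := ★
`blockFFT ∕ blockFFT_swap`; (DX⁺)(DX⁻) := ★ `hDXp∕hDXm_directed_of_onePlaceLetter` ∘ ★ `onePlaceLetter_directed_of_junctionFrames … hDX`; (dom) := ★ `hdom_of_hermiteData hdat`;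
(vac) := ★ `vac_good_of_base` ∘ ★ `hHL_of_hermiteData (hdat 0)` + (base).  Residual letters: the closure letters, `hbase`, `hdat`, `ht hodd`, `hα`, the frames, `hDX`.
[cite: Howe1989, §3] [cite: KudlaRallis1994, §1 Thm. 1.1, §3] [cite: Folland1989, §1.7 (1.81), §4.2 Prop. (4.39)] [cite: KonnoKonno2007, Lemma 5.2 p. 73] [cite: Weyl1939, Thm. 2.6.A]
[cite: Liu2021, App. B proof of Prop. B.8 pp. 103–106] -/
theorem good_tupleVec_directed_at_junctionFrames (DX : Matrix (Fin (n + n)) (Fin (n + n)) (mixedSpace L) → Prop)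
    (Good : (V : Submodule ℂ 𝓢(((Fin (n' + n')) → mixedSpace (Fp L)), ℂ)) → ↥(Submodule.span ℂ {x : piSchwartzBruhat (Fp L) (Fin (n' + n')) |
          ∃ a ∈ V, ∃ f : FinSB (Fp L) (Fin (n' + n')), x = piSchwartzBruhatEquiv (Fp L) (Fin (n' + n')) (a ⊗ₜ[ℂ] f)}) → Prop)
    -- (congr) (zero) (add) (smul): ★ `hGgen` bytes verbatim; (deriv) DIRECTED: ★ `faceG_of_organs_directed`'s `hGgen` :220–228 (`DX L e dV hdV dW hdW` spelled `DX`)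
    (hcongr : ∀ (V V' : Submodule ℂ 𝓢(((Fin (n' + n')) → mixedSpace (Fp L)), ℂ)) (x : ↥(Submodule.span ℂ {x : piSchwartzBruhat (Fp L) (Fin (n' + n')) |
          ∃ a ∈ V, ∃ f : FinSB (Fp L) (Fin (n' + n')), x = piSchwartzBruhatEquiv (Fp L) (Fin (n' + n')) (a ⊗ₜ[ℂ] f)})) (x' : ↥(Submodule.span ℂ {x : piSchwartzBruhat (Fp L) (Fin (n' + n')) |
          ∃ a ∈ V', ∃ f : FinSB (Fp L) (Fin (n' + n')), x = piSchwartzBruhatEquiv (Fp L) (Fin (n' + n')) (a ⊗ₜ[ℂ] f)})),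
      genFamily L e dV hdV hdV0 dW hdW hdW0 eW e' dV' hdV' hdV'0 χb hχbu hχbs α 𝒦 (x : piSchwartzBruhat (Fp L) (Fin (n' + n'))) =
        genFamily L e dV hdV hdV0 dW hdW hdW0 eW e' dV' hdV' hdV'0 χb hχbu hχbs α 𝒦 (x' : piSchwartzBruhat (Fp L) (Fin (n' + n'))) → Good V x → Good V' x')
    (hzero : ∀ (V : Submodule ℂ 𝓢(((Fin (n' + n')) → mixedSpace (Fp L)), ℂ)), FiniteDimensional ℂ V → IsArchStable L e dV hdV hdV0 dW hdW hdW0 eW e' dV' hdV' hdV'0 χb hχbu hχbs 𝒦 V → Good V 0)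
    (hadd : ∀ (V : Submodule ℂ 𝓢(((Fin (n' + n')) → mixedSpace (Fp L)), ℂ)), FiniteDimensional ℂ V → IsArchStable L e dV hdV hdV0 dW hdW hdW0 eW e' dV' hdV' hdV'0 χb hχbu hχbs 𝒦 V →
      ∀ x y : ↥(Submodule.span ℂ {x : piSchwartzBruhat (Fp L) (Fin (n' + n')) |
          ∃ a ∈ V, ∃ f : FinSB (Fp L) (Fin (n' + n')), x = piSchwartzBruhatEquiv (Fp L) (Fin (n' + n')) (a ⊗ₜ[ℂ] f)}), Good V x → Good V y → Good V (x + y))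
    (hsmul : ∀ (V : Submodule ℂ 𝓢(((Fin (n' + n')) → mixedSpace (Fp L)), ℂ)), FiniteDimensional ℂ V → IsArchStable L e dV hdV hdV0 dW hdW hdW0 eW e' dV' hdV' hdV'0 χb hχbu hχbs 𝒦 V →
      ∀ (c : ℂ) (x : ↥(Submodule.span ℂ {x : piSchwartzBruhat (Fp L) (Fin (n' + n')) |
          ∃ a ∈ V, ∃ f : FinSB (Fp L) (Fin (n' + n')), x = piSchwartzBruhatEquiv (Fp L) (Fin (n' + n')) (a ⊗ₜ[ℂ] f)})), Good V x → Good V (c • x))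
    (hderiv : ∀ (V : Submodule ℂ 𝓢(((Fin (n' + n')) → mixedSpace (Fp L)), ℂ)), FiniteDimensional ℂ V → IsArchStable L e dV hdV hdV0 dW hdW hdW0 eW e' dV' hdV' hdV'0 χb hχbu hχbs 𝒦 V →
          ∀ x : ↥(Submodule.span ℂ {x : piSchwartzBruhat (Fp L) (Fin (n' + n')) |
          ∃ a ∈ V, ∃ f : FinSB (Fp L) (Fin (n' + n')), x = piSchwartzBruhatEquiv (Fp L) (Fin (n' + n')) (a ⊗ₜ[ℂ] f)}), Good V x →
          ∀ (X : Matrix (Fin (n + n)) (Fin (n + n)) (mixedSpace L)) (hX : X ∈ archSkew (Fp L) L (IsCMField.complexConj L) (n + n) (hermD L e dV hdV dW hdW)) (_hXD : DX X)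
            (V' : Submodule ℂ 𝓢(((Fin (n' + n')) → mixedSpace (Fp L)), ℂ)), FiniteDimensional ℂ V' → IsArchStable L e dV hdV hdV0 dW hdW hdW0 eW e' dV' hdV' hdV'0 χb hχbu hχbs 𝒦 V' →
          ∀ x' : ↥(Submodule.span ℂ {x : piSchwartzBruhat (Fp L) (Fin (n' + n')) |
          ∃ a ∈ V', ∃ f : FinSB (Fp L) (Fin (n' + n')), x = piSchwartzBruhatEquiv (Fp L) (Fin (n' + n')) (a ⊗ₜ[ℂ] f)}),
          HasArchDeriv L e dV hdV dW hdW hX (fun h => genFamily L e dV hdV hdV0 dW hdW hdW0 eW e' dV' hdV' hdV'0 χb hχbu hχbs α 𝒦 (x : piSchwartzBruhat (Fp L) (Fin (n' + n'))) ((((3 : ℕ) : ℂ) - (n : ℂ)) / 2) h)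
            (fun h => genFamily L e dV hdV hdV0 dW hdW hdW0 eW e' dV' hdV' hdV'0 χb hχbu hχbs α 𝒦 (x' : piSchwartzBruhat (Fp L) (Fin (n' + n'))) ((((3 : ℕ) : ℂ) - (n : ℂ)) / 2) h) → Good V' x')
    -- (base) of ★ `hGgen` at the hol cut of record `HL₀ := HLrecOfRecord …` (★ LH7-p05; `= holCutOfRecord …`, «`V₀ = ℂ ∙ v_G`»), bytes of ★ `faceG_of_organs` :194–196
    (hbase : ∀ (V₀ : Submodule ℂ 𝓢(((Fin (n' + n')) → mixedSpace (Fp L)), ℂ)), FiniteDimensional ℂ V₀ → IsArchStable L e dV hdV hdV0 dW hdW hdW0 eW e' dV' hdV' hdV'0 χb hχbu hχbs 𝒦 V₀ →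
      HLrecOfRecord L dV hdV hdV0 dW hdW hdW0 eW e' dV' hdV' hdV'0 V₀ → ∀ x₀ : ↥(Submodule.span ℂ {x : piSchwartzBruhat (Fp L) (Fin (n' + n')) |
          ∃ a ∈ V₀, ∃ f : FinSB (Fp L) (Fin (n' + n')), x = piSchwartzBruhatEquiv (Fp L) (Fin (n' + n')) (a ⊗ₜ[ℂ] f)}), Good V₀ x₀)
    -- (dat) the Hermite data BY VALUE: every Hermite span `V_D` of the doubled frame is an arch datum for `𝒦` (★ σ15 `isArchDatum_hermiteSpan … 𝒦 hK D`; K2E3-p31's ★ bytes)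
    (hdat : ∀ D : ℕ, IsArchDatum L e dV hdV dW hdW eW e' dV' hdV'
      (doubledWeilRep L e' dV hdV hdV0 (tensorFrame L dW eW dV') (tensorFrame_real L dW hdW eW dV' hdV') (tensorFrame_ne_zero L dW eW dV' hdW0 hdV'0) χb hχbu hχbs) 𝒦
      (Submodule.span ℂ {x : 𝓢((Fin (n' + n') → mixedSpace (Fp L)), ℂ) | ∃ γ : (Fin (n' + n') × {v : InfinitePlace (Fp L) // v.IsReal}) →₀ ℕ, γ.degree ≤ D ∧
        follandHermite (GRConstruction.frameD L e' dV hdV hdV0 (tensorFrame L dW eW dV') (tensorFrame_real L dW hdW eW dV' hdV') (tensorFrame_ne_zero L dW eW dV' hdW0 hdV'0)) γ = x}))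
    -- the arch type of `χb` (odd unitary type `(t, 0)`, as ★ (P-arch) ∕ ★ p863344)
    {t : InfinitePlace L → ℤ} (ht : χb.HasUnitaryArchType t 0) (hodd : ∀ w, Odd (t w))
    (hα : Continuous α)
    -- the junction frames of record (★ `exists_junctionFrameData_embedding`: `y σ k = σ(dV′ k)`) and the small sign frames (★ `exists_signFrame_two`)
    (y : {v : InfinitePlace (Fp L) // v.IsReal} → Fin 3 → ℝ) (hy : ∀ σ k, y σ k ≠ 0)
    (hz : ∀ (σ : {v : InfinitePlace (Fp L) // v.IsReal}) j, (signVec (cmPlaceOver L) (fun k => Sum.elim (cmGramEntry L e' dV hdV (tensorFrame L dW eW dV') (tensorFrame_real L dW hdW eW dV' hdV')) (-cmGramEntry L e' dV hdV (tensorFrame L dW eW dV') (tensorFrame_real L dW hdW eW dV' hdV')) ((LocalSplitting.e₂ n').symm k)) (imagUnit L) σ) j = (signVec (cmPlaceOver L) (fun k => Sum.elim (cmGramEntry L e dV hdV dW hdW) (-cmGramEntry L e dV hdV dW hdW) ((LocalSplitting.e₂ n).symm k)) (imagUnit L) σ) ((epsD e eW e').symm j).1 * y σ ((epsD e eW e').symm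 j).2)
    (eP₀ : ∀ σ : {v : InfinitePlace (Fp L) // v.IsReal}, (PosIdx (signVec (cmPlaceOver L) (fun k => Sum.elim (cmGramEntry L e dV hdV dW hdW) (-cmGramEntry L e dV hdV dW hdW) ((LocalSplitting.e₂ n).symm k)) (imagUnit L) σ) × PosIdx (y σ)) ⊕ (NegIdx (signVec (cmPlaceOver L) (fun k => Sum.elim (cmGramEntry L e dV hdV dW hdW) (-cmGramEntry L e dV hdV dW hdW) ((LocalSplitting.e₂ n).symm k)) (imagUnit L) σ) × NegIdx (y σ)) ≃ PosIdx (signVec (cmPlaceOver L) (fun k => Sum.elim (cmGramEntry L e' dV hdV (tensorFrame L dW eW dV') (tensorFrame_real L dW hdW eW dV' hdV')) (-cmGramEntry L e' dV hdV (tensorFrame L dW eW dV') (tensorFrame_real L dW hdW eW dV' hdV')) ((LocalSplitting.e₂ n').symm k)) (imagUnit L) σ))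
    (eQ₀ : ∀ σ : {v : InfinitePlace (Fp L) // v.IsReal}, (PosIdx (signVec (cmPlaceOver L) (fun k => Sum.elim (cmGramEntry L e dV hdV dW hdW) (-cmGramEntry L e dV hdV dW hdW) ((LocalSplitting.e₂ n).symm k)) (imagUnit L) σ) × NegIdx (y σ)) ⊕ (NegIdx (signVec (cmPlaceOver L) (fun k => Sum.elim (cmGramEntry L e dV hdV dW hdW) (-cmGramEntry L e dV hdV dW hdW) ((LocalSplitting.e₂ n).symm k)) (imagUnit L) σ) × PosIdx (y σ)) ≃ NegIdx (signVec (cmPlaceOver L) (fun k => Sum.elim (cmGramEntry L e' dV hdV (tensorFrame L dW eW dV') (tensorFrame_real L dW hdW eW dV' hdV')) (-cmGramEntry L e' dV hdV (tensorFrame L dW eW dV') (tensorFrame_real L dW hdW eW dV' hdV')) ((LocalSplitting.e₂ n').symm k)) (imagUnit L) σ))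
    (hE : ∀ (σ : {v : InfinitePlace (Fp L) // v.IsReal}) i, (dpEquiv _ _ _ _).symm (((eP₀ σ).sumCongr (eQ₀ σ)).symm i) =
      (signSplit (signVec (cmPlaceOver L) (fun k => Sum.elim (cmGramEntry L e dV hdV dW hdW) (-cmGramEntry L e dV hdV dW hdW) ((LocalSplitting.e₂ n).symm k)) (imagUnit L) σ) ((epsD e eW e').symm ((signSplit (signVec (cmPlaceOver L) (fun k => Sum.elim (cmGramEntry L e' dV hdV (tensorFrame L dW eW dV') (tensorFrame_real L dW hdW eW dV' hdV')) (-cmGramEntry L e' dV hdV (tensorFrame L dW eW dV') (tensorFrame_real L dW hdW eW dV' hdV')) ((LocalSplitting.e₂ n').symm k)) (imagUnit L) σ)).symm i)).1, signSplit (y σ) ((epsD e eW e').symm ((signSplit (signVec (cmPlaceOver L) (fun k => Sum.elim (cmGramEntry L e' dV hdV (tensorFrame L dW eW dV') (tensorFrame_real L dW hdW eW dV' hdV')) (-cmGramEntry L e' dV hdV (tensorFrame L dW eW dV') (tensorFrame_real L dW hdW eW dV' hdV')) ((LocalSplitting.e₂ n').symm k)) (imagUnit L) σ)).symm i)).2)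)
    (hyσ : ∀ (σ : {v : InfinitePlace (Fp L) // v.IsReal}) k, embedding_of_isReal σ.2 (⟨dV' k, (IsCMField.complexConj_eq_self_iff (K := L) (dV' k)).1 (hdV' _)⟩ : Fp L) = y σ k)
    (eSp : ∀ σ : {v : InfinitePlace (Fp L) // v.IsReal}, Fin 2 ≃ PosIdx (signVec (cmPlaceOver L) (fun k => Sum.elim (cmGramEntry L e dV hdV dW hdW) (-cmGramEntry L e dV hdV dW hdW) ((LocalSplitting.e₂ n).symm k)) (imagUnit L) σ)) (eSq : ∀ σ : {v : InfinitePlace (Fp L) // v.IsReal}, Fin 2 ≃ NegIdx (signVec (cmPlaceOver L) (fun k => Sum.elim (cmGramEntry L e dV hdV dW hdW) (-cmGramEntry L e dV hdV dW hdW) ((LocalSplitting.e₂ n).symm k)) (imagUnit L) σ))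
    -- THE DIRECTION LETTER: `DX` holds at every chart-image direction at the junction frames (★ `onePlaceLetter_directed_of_junctionFrames`' binder, bytes verbatim)
    (hDX : letI : LieRing (Matrix (Fin 2 ⊕ Fin 2) (Fin 2 ⊕ Fin 2) ℂ) := LieRing.ofAssociativeRing
      ∀ (σ : {v : InfinitePlace (Fp L) // v.IsReal}) (Y : ↥(uFormGroup (Fin 2) (Fin 2)).lie.toSubmodule) (X : Matrix (Fin (n + n)) (Fin (n + n)) (mixedSpace L)) (hX : X ∈ archSkew (Fp L) L (IsCMField.complexConj L) (n + n) (hermD L e dV hdV dW hdW)),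
      (∀ s : ℝ, K2LiuArchOneParameterOrbitDefs.archExp (Fp L) L (IsCMField.complexConj L) (n + n) (hermD L e dV hdV dW hdW) hX s =
        K2LiuArchOneParameterOrbitDefs.archEmb (Fp L) L (IsCMField.complexConj L) (n + n) (hermD L e dV hdV dW hdW)
          (placeSecJ L (IsCMField.complexConj L) (n + n) (IsCMField.complexConj_ne_one L) (cmPlaceOver L) (cmPlaceOver_smul L) _
            (gramD_gram_realDiagonal_entry_ne_zero L e dV hdV dW hdW hdV0 hdW0) (complexConj_imagUnit L) (imagUnit_ne_zero L) σ
            (cmPlaceOver_comap L) (gramD_eq_diagonal_cm L e dV hdV dW hdW) (J := hermD L e dV hdV dW hdW) rfl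
            (complexConj_smul_infinitePlace L) (eSp σ).symm (eSq σ).symm
            ((((uFormGroup (Fin 2) (Fin 2)).expMem
                ⟨((s • Y : ↥(uFormGroup (Fin 2) (Fin 2)).lie.toSubmodule) : Matrix (Fin 2 ⊕ Fin 2) (Fin 2 ⊕ Fin 2) ℂ), (s • Y).2⟩ :
                UForm (Fin 2) (Fin 2)), (1 : UForm Unit Empty)) : Ginf (Fin 2) (Fin 2) Unit Empty))) → DX X) :
    ∀ (a : ((σ : {v : InfinitePlace (Fp L) // v.IsReal}) → MvPolynomial (DPIdx (Fin 2) (Fin 2) (PosIdx (y σ)) (NegIdx (y σ))) ℂ)) (f : FinSB (Fp L) (Fin (n' + n'))) (V' : Submodule ℂ 𝓢(((Fin (n' + n')) → mixedSpace (Fp L)), ℂ)), FiniteDimensional ℂ V' →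
      IsArchStable L e dV hdV hdV0 dW hdW hdW0 eW e' dV' hdV' hdV'0 χb hχbu hχbs 𝒦 V' →
      ∀ hx : piSchwartzBruhatEquiv (Fp L) (Fin (n' + n')) (tupleVec L dV hdV hdV0 dW hdW hdW0 eW e' dV' hdV' hdV'0 (fun σ => PosIdx (y σ)) (fun σ => NegIdx (y σ))
          (fun σ => (eP₀ σ).symm.trans (Equiv.sumCongr ((eSp σ).symm.prodCongr (Equiv.refl (PosIdx (y σ)))) ((eSq σ).symm.prodCongr (Equiv.refl (NegIdx (y σ))))))
          (fun σ => (eQ₀ σ).symm.trans (Equiv.sumCongr ((eSp σ).symm.prodCongr (Equiv.refl (NegIdx (y σ)))) ((eSq σ).symm.prodCongr (Equiv.refl (PosIdx (y σ)))))) a ⊗ₜ[ℂ] f) ∈ Submodule.span ℂ {x : piSchwartzBruhat (Fp L) (Fin (n' + n')) |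
          ∃ a ∈ V', ∃ f : FinSB (Fp L) (Fin (n' + n')), x = piSchwartzBruhatEquiv (Fp L) (Fin (n' + n')) (a ⊗ₜ[ℂ] f)},
        Good V' ⟨piSchwartzBruhatEquiv (Fp L) (Fin (n' + n')) (tupleVec L dV hdV hdV0 dW hdW hdW0 eW e' dV' hdV' hdV'0 (fun σ => PosIdx (y σ)) (fun σ => NegIdx (y σ))
          (fun σ => (eP₀ σ).symm.trans (Equiv.sumCongr ((eSp σ).symm.prodCongr (Equiv.refl (PosIdx (y σ)))) ((eSq σ).symm.prodCongr (Equiv.refl (NegIdx (y σ))))))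
          (fun σ => (eQ₀ σ).symm.trans (Equiv.sumCongr ((eSp σ).symm.prodCongr (Equiv.refl (NegIdx (y σ)))) ((eSq σ).symm.prodCongr (Equiv.refl (PosIdx (y σ)))))) a ⊗ₜ[ℂ] f), hx⟩ := by
  letI : LieRing (Matrix (Fin 2 ⊕ Fin 2) (Fin 2 ⊕ Fin 2) ℂ) := LieRing.ofAssociativeRing  -- `𝔲(2,2)` (as ★ K2Liu-p05)
  -- `|P| = |Q| = n` at `P = Q = Fin 2` from the model's `e : Fin 2 × Fin 1 ≃ Fin n`
  have hn : Fintype.card (Fin 2) = n := by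
    have h := Fintype.card_congr e
    simp only [Fintype.card_prod, Fintype.card_fin, mul_one] at h
    rw [Fintype.card_fin]
    exact h
  -- the directed one-place letter at the junction frames (★ K2Liu-p05)
  have hψD := K2LiuArchSWDataDerivLettersDirected.onePlaceLetter_directed_of_junctionFrames L e dV hdV hdV0 dW hdW hdW0 eW e' dV' hdV' hdV'0 α DX hα y hy hz eP₀ eQ₀ hE eSp eSq hDX
  refine good_tupleVec_of_frame_directed L e dV hdV hdV0 dW hdW hdW0 eW e' dV' hdV' hdV'0 χb hχbu hχbs α 𝒦 (fun σ => PosIdx (y σ)) (fun σ => NegIdx (y σ))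
    (fun σ => (eP₀ σ).symm.trans (Equiv.sumCongr ((eSp σ).symm.prodCongr (Equiv.refl (PosIdx (y σ)))) ((eSq σ).symm.prodCongr (Equiv.refl (NegIdx (y σ))))))
    (fun σ => (eQ₀ σ).symm.trans (Equiv.sumCongr ((eSp σ).symm.prodCongr (Equiv.refl (NegIdx (y σ)))) ((eSq σ).symm.prodCongr (Equiv.refl (PosIdx (y σ))))))
    (fun σ => (⟨-(Fintype.card (NegIdx (y σ)) : ℤ), -(Fintype.card (PosIdx (y σ)) : ℤ), -(Fintype.card (Fin 2) : ℤ), -(Fintype.card (Fin 2) : ℤ)⟩ : VacExponents))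
    DX Good hcongr hzero hadd hsmul hderiv
    (K2LiuArchSWDataDomainLetters.hdom_of_hermiteData L e dV hdV hdV0 dW hdW hdW0 eW e' dV' hdV' hdV'0 χb hχbu hχbs 𝒦 _ _ _ _ hdat)
    _ (frame_tupleVec_eq_tensorPi L dV hdV hdV0 dW hdW hdW0 eW e' dV' hdV' hdV'0 _ _ _ _) (fun σ k v w f a a' ha ha' => ?_)
    (fun σ PR hPR => K2LiuFockKHInvariantsFFT.blockFFT PR hPR) (fun σ PS hPS => K2LiuFockKHInvariantsFFT.blockFFT_swap PS hPS)
    (K2LiuArchSWDataDerivLettersDirected.hDXp_directed_of_onePlaceLetter L e dV hdV hdV0 dW hdW hdW0 eW e' dV' hdV' hdV'0 χb hχbu hχbs α 𝒦 _ _ _ _ DX ht hodd hψD)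
    (K2LiuArchSWDataDerivLettersDirected.hDXm_directed_of_onePlaceLetter L e dV hdV hdV0 dW hdW hdW0 eW e' dV' hdV' hdV'0 χb hχbu hχbs α 𝒦 _ _ _ _ DX ht hodd hψD)
    (vac_good_of_base L e dV hdV hdV0 dW hdW hdW0 eW e' dV' hdV' hdV'0 χb hχbu hχbs α 𝒦 _ _ _ _ Good
      (fun V₀ => K2LiuArchGaussianOfRecord.HLrecOfRecord L dV hdV hdV0 dW hdW hdW0 eW e' dV' hdV' hdV'0 V₀) hbase hcongr
      (K2LiuArchSWDataDomainLetters.hHL_of_hermiteData L e dV hdV hdV0 dW hdW hdW0 eW e' dV' hdV' hdV'0 χb hχbu hχbs 𝒦 _ _ _ _ (hdat 0)))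
  -- (piv): ★ (A) at `sB := doubledWeilRep χb`, every `h ∈ U(𝔻)(𝔸)`, read through `genFamily` (★ FILE 2d ED. 1's glue)
  have key : ∀ h : HA L e dV hdV dW hdW,
      swSectionTensor L e dV hdV dW hdW eW e' dV' hdV' hdV0 hdW0 hdV'0
          (doubledWeilRep L e' dV hdV hdV0 (tensorFrame L dW eW dV') (tensorFrame_real L dW hdW eW dV' hdV') (tensorFrame_ne_zero L dW eW dV' hdW0 hdV'0) χb hχbu hχbs)
          (piSchwartzBruhatEquiv (Fp L) (Fin (n' + n')) (a' ⊗ₜ[ℂ] f)) h =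
        vacScalar (⟨-(Fintype.card (NegIdx (y σ)) : ℤ), -(Fintype.card (PosIdx (y σ)) : ℤ), -(Fintype.card (Fin 2) : ℤ), -(Fintype.card (Fin 2) : ℤ)⟩ : VacExponents)
            (((1 : Matrix.unitaryGroup (Fin 2) ℂ × Matrix.unitaryGroup (Fin 2) ℂ), k) : DPK (Fin 2) (Fin 2) (PosIdx (y σ)) (NegIdx (y σ))) *
          swSectionTensor L e dV hdV dW hdW eW e' dV' hdV' hdV0 hdW0 hdV'0
            (doubledWeilRep L e' dV hdV hdV0 (tensorFrame L dW eW dV') (tensorFrame_real L dW hdW eW dV' hdV') (tensorFrame_ne_zero L dW eW dV' hdW0 hdV'0) χb hχbu hχbs)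
            (piSchwartzBruhatEquiv (Fp L) (Fin (n' + n')) (a ⊗ₜ[ℂ] f)) h := fun h => by
    rw [swSectionTensor_apply, swSectionTensor_apply]
    exact K2LiuArchSWPivotDischarge.swSection_junctionSlot_κOp_eq_vacScalar_mul_at_junctionFrames L e dV hdV hdV0 dW hdW hdW0 eW e' dV' hdV' hdV'0 σ hχbu hχbs
      (isDoubledWeilRep_doubledWeilRep L e' dV hdV hdV0 (tensorFrame L dW eW dV') (tensorFrame_real L dW hdW eW dV' hdV') (tensorFrame_ne_zero L dW eW dV' hdW0 hdV'0) χb hχbu hχbs)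
      ht hodd hn hn (y σ) (hy σ) (hyσ σ) (hz σ) (eP₀ σ) (eQ₀ σ) (hE σ) (eSp σ) (eSq σ) f h k v w a a' ha ha'
  have hT : swSectionTensor L e dV hdV dW hdW eW e' dV' hdV' hdV0 hdW0 hdV'0
          (doubledWeilRep L e' dV hdV hdV0 (tensorFrame L dW eW dV') (tensorFrame_real L dW hdW eW dV' hdV') (tensorFrame_ne_zero L dW eW dV' hdW0 hdV'0) χb hχbu hχbs)
          (piSchwartzBruhatEquiv (Fp L) (Fin (n' + n')) (a' ⊗ₜ[ℂ] f)) =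
        vacScalar (⟨-(Fintype.card (NegIdx (y σ)) : ℤ), -(Fintype.card (PosIdx (y σ)) : ℤ), -(Fintype.card (Fin 2) : ℤ), -(Fintype.card (Fin 2) : ℤ)⟩ : VacExponents)
            (((1 : Matrix.unitaryGroup (Fin 2) ℂ × Matrix.unitaryGroup (Fin 2) ℂ), k) : DPK (Fin 2) (Fin 2) (PosIdx (y σ)) (NegIdx (y σ))) •
          swSectionTensor L e dV hdV dW hdW eW e' dV' hdV' hdV0 hdW0 hdV'0
            (doubledWeilRep L e' dV hdV hdV0 (tensorFrame L dW eW dV') (tensorFrame_real L dW hdW eW dV' hdV') (tensorFrame_ne_zero L dW eW dV' hdW0 hdV'0) χb hχbu hχbs)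
            (piSchwartzBruhatEquiv (Fp L) (Fin (n' + n')) (a ⊗ₜ[ℂ] f)) := by
    funext h
    rw [Pi.smul_apply, smul_eq_mul]
    exact key h
  funext s h
  simp only [K2LiuFaceGLetterDefs.genFamily, Pi.smul_apply, smul_eq_mul]
  rw [hT, stdExtension_smul, Pi.smul_apply, Pi.smul_apply, smul_eq_mul]
  ring

end Summit.HodgeConjecture.HodgeConjecture.Cruxes.HLiu418.K2LiuArchSWDataInductionDirected

end
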